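import Summits.SmoothPoincare4.SmoothPoincare4.Theses.ConvexBisection
import Literature.Topology.FourManifolds.DehnTwistFactorisation
import Literature.Topology.FourManifolds.AchiralLefschetzModel
import Literature.Topology.FourManifolds.HurwitzDeletionCalculus
import Literature.Topology.FourManifolds.AchiralLefschetzNullTower
import Literature.Topology.FourManifolds.AchiralLefschetzNullTowerContractible
import Literature.Topology.FourManifolds.AchiralLefschetzNullTowerNil
import Literature.Topology.FourManifolds.AchiralLefschetzNullTowerTrace
import Literature.Topology.FourManifolds.SPC4Handles
import Literature.Topology.FourManifolds.SteinBisectionAchiralWordModel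
import Literature.Topology.FourManifolds.LefschetzHandlebodyEuler
import Literature.Topology.FourManifolds.PageSystemBetti
import Literature.Geometry.Symplectic.SteinDomainPALF
import Summits.SmoothPoincare4.SmoothPoincare4.Theorems.ConvexBisectionPlanarBisectionExistsConnectedHalves
import Literature.Topology.FourManifolds.Morse
import Literature.Topology.FourManifolds.HomotopyS4CompactProofs
import HarnessLib

/-!
# Line `hurwitz-deletion-presentation` for crux `ConvexBisection.AcyclicBisectionRigidity`
(item stmt-SmoothPoincare4-10507, route `route-SmoothPoincare4-ConvexBisection`, rank 2)

Skeleton (crux-strategist / wall-breaker `cstrat-stmt-SmoothPoincare4-10507-p1`, 2026-08-17, after two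
ideation rounds and 15 dead lines) of the one round-2 crux idea that passed triage ×3
(`Cruxes/AcyclicBisectionRigidity/Ideas/hurwitz-deletion-presentation.md`, TRIAGE-r2-1/2/3: pass;
standing disprover `Disproof.lean` §13e: "`HN^stab` survives") and was never planned, RE-CUT so that
its apex is typable over the tree's word calculus, dodges the ONE cheap obstruction that killed its
unstabilised planar sibling (the type count of `Negative/HurwitzTypeCount.lean`, Disproof §13c), and is
NOT the crux or the summit in a costume (the disease of every round-2 apex: p117673, p153586).

THE CRUX. For every Hausdorff second-countable `C^∞` 4-manifold `M ≃ₕ S⁴`: if `M = e₁(W₁) ∪ e₂(W₂)`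
for two smoothly embedded compact Stein domains meeting exactly along the images of their boundaries,
complex tangencies pushed forward to ONE plane field on the seam, both halves ℚ-acyclic in positive
degrees, then `M ≅ S⁴`.

THE LEVER. Read the bisection as an ACHIRAL WORD. Both halves are positive allowable Lefschetz
fibrations over `D²` (Akbulut–Ozbagci 2001 / Loi–Piergallini 2001); after a COMMON positive
stabilisation of the two supporting open books (Giroux 2002) — pushed on until the binding is
CONNECTED — they are `X(P; a)` and `X(P; b)` for two POSITIVE words `a`, `b` over one page
`P = S_{g,1}` with `monodromy a = monodromy b`, and `M = X(P; a) ∪_∂ X̄(P; b)` is the closed achiral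
Lefschetz model `X̂(P; a · b̄)` of the tree (`IsAchiralLefschetzModel`, `AchiralLefschetzModel.lean`).
ℚ-acyclicity of a half `⇔ |a| = b₁(P) = 2g` and the vanishing cycles are a ℚ-basis of `H₁(P; ℚ)`; in
particular EVERY letter is a NON-SEPARATING curve, and non-separating curves of `S_{g,1}` are ONE
`Mod(P, ∂P)`-orbit — so the conjugation-invariant type counts of `Negative/HurwitzTypeCount` vanish
identically on these words (`|a| = |b|`): the obstruction that refuted monotone reducibility at
`k = 5` (planar page, disjoint hole-types; Disproof §13c, lattice lemma §13e: "T fails on the whole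
planar torsion sector") CANNOT BITE at connected binding, and no page-changing stabilisation (which the
tree cannot type: `DehnTwistFactorisation.lean`, "Not here") is needed any more. The moves that re-read
the SAME `M`: Hurwitz moves and global conjugation (`Move`, tree; Gompf–Stipsicz §8.2); the move that
changes `M` by exactly a CIRCLE SURGERY: DELETION of an adjacent pair `(c, ε)(d, ¬ε)` with
`t_c = t_d` (Kirby: `{K^{pf-1}, K'^{pf+1}} ↝ {K, μ_K⁰}` = surgery on `K` pushed into the fibre;
TRIAGE-r2-3 gen-0 check; this file's strategist re-derived it). APEX (`stub_hurwitzNullConnectedBinding`,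
HN₁): every such homotopy-sphere word `a · b̄` over a connected-binding page is HURWITZ-NULL — reducible
to `[]` by moves and deletions. Then (`stub_nullTower`) `M` is obtained from
`X̂(P; []) = #^{2g} S¹ × S³` by `2g` circle surgeries and diffeomorphisms, i.e. `M = ∂H⁵`, `H` a compact
5-dimensional 2-handlebody, contractible since `π₁ M = 1` (and then `H₂ H = 0` by the exact sequence of
`(H, M)`): `M` is a PRESENTATION SPHERE, and item stmt-SmoothPoincare4-3717
(`PresentationSpheresStandard`, shared crux of routes EntropyLadder / ConvexityLadder / RicciTranscript)
closes. At genus `1` no AC input is needed at all: after one deletion the model is `S¹ × S³`, where a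
circle killing `π₁` is a generator, hence standard, and both surgery framings give `S⁴` (5-dimensional
1/2-cancellation) — recorded in the line card as the lead's first closed rung.

WHY THIS IS NOT A COSTUME (the test every round-2 apex failed). HN₁ is a statement about WORDS in
`Mod(S_{g,1}, ∂)`: it is NOT implied by `SmoothPoincare4` (the round `S⁴` may well carry non-null
connected-binding words — an orbit invariant finer than homology would exhibit one), it is NOT implied
by the crux, it is decidable instance by instance (genus 1: `Mod = B₃`, faithfully `SL₂(ℤ) × ℤ`; genus
2: `Mod(S_{2,1}) ↪ Aut F₄`, Dehn–Nielsen–Baer), and it can therefore DIE WITHOUT AN EXOTIC SPHERE —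
exactly the "teeth" the chain lacked. Its first-deletion shadow is the disprover's criterion
`exists_conj_inv_of_monotoneReducible` (§13e): some `bⱼ` must lie in the `H`-orbit of some `aᵢ`,
`H = ⟨t_{a₁}, …, t_{b_{2g}}⟩` — unobstructed by any abelian invariant at connected binding.

THE LINE (four registered stubs; composition `AcyclicBisectionRigidity_of` kernel-checked, no `sorry`
of its own; sorry-free calibration: doubles `a · ā` are null with zero Hurwitz moves, the double
sector of Disproof §12):
* `stub_factDictionary` (reshape s4, lead c10) — the FIVE printed inputs of the dictionary as named Literature
  facts (`SteinDomainPALF.lean` p159609, `SteinBisectionAchiralWordModel.lean` p163059); the dictionary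
  itself (`achiralWordModel_of_facts`) is PROVED from them; not SPC4-shaped.
* `stub_hurwitzNullConnectedBinding` — APEX HN₁ (open; refutable by computation; genus 1 = `B₃`).
* `stub_factNullTower` (reshape s2, lead c10) — the FIVE printed inputs of the deletion tower as named
  Literature facts (`AchiralLefschetzNullTower.lean`, p159779); the tower itself
  (`nullTower_of_facts`: null word + `M ≃ₕ S⁴` ⇒ `M` bounds a compact contractible 5-manifold with an
  adapted Morse function of index `≤ 2` — verbatim the hypothesis of item 3717) is PROVED from them.
* `stub_presentationSpheresStandard` — item stmt-SmoothPoincare4-3717 VERBATIM (shared, SPC4-shielded,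
  owned by three other routes; the honest residual, as the card said).
Disproof used: `false_without_homotopyEquiv` honoured (`M ≃ₕ S⁴` consumed by the apex, the tower and
3717; the dictionary uses only `M` nonempty connected, derived from it); no `-- Targets` of
Disproof.lean names a statement of this file; `Negative/HurwitzTypeCount` and the first-deletion
criterion are answered above; no stub is an instance of `Negative/RoundTwoLevers` (`DoubleReduction`)
or of the twins family (`TwinDecomposition`): the halves are never compared.
-/

noncomputable section

open scoped Manifold ContDiff Topology ContinuousMap
open Set Function
open CategoryTheory.Limits
open Literature.Geometry.Symplectic Literature.AlgebraicTopology.SingularHomology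
open Literature.Topology.FourManifolds

-- The namespace is prescribed by the crux protocol (`Summit.<P>.<Sub>.Cruxes.<Crux>.<Slug>` with
-- `P = Sub = SmoothPoincare4`), hence the duplicated component.
set_option linter.dupNamespace false
set_option linter.unusedVariables false
set_option linter.unusedSectionVars false

namespace Summit.SmoothPoincare4.SmoothPoincare4.Cruxes.AcyclicBisectionRigidity.HurwitzDeletionPresentation

open Summit.SmoothPoincare4.SmoothPoincare4.Theses

/-- Local notation: `𝔼 n = ℝⁿ` (model space). -/
local notation "𝔼 " n:arg => EuclideanSpace ℝ (Fin n)

/-- Local notation: the round 4-sphere `S⁴ ⊂ ℝ⁵`, the carrier of the summit statement. -/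
local notation "𝕊⁴" => (Metric.sphere (0 : EuclideanSpace ℝ (Fin 5)) 1)

/-- A point of the round 4-sphere (to pull non-emptiness of `M` back along `M ≃ₕ S⁴`). -/
def northPole : 𝕊⁴ :=
  ⟨EuclideanSpace.single 0 1, by simp⟩

/-! ## §0 The deletion calculus — MOVED to `Literature/Topology/FourManifolds/HurwitzDeletionCalculus.lean`
(p158626, lead c10): `toSigned`, `signedWord`, `letterInv`, `Deletion`, `NullStep`, `IsHurwitzNull`,
`PureHurwitzEquivalent` and the sorry-free calibration (`isHurwitzNull_append_letterInv`: doubles are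
null with zero Hurwitz moves; `isHurwitzNull_append_letterInv_of_pureHurwitzEquivalent`: the purely
Hurwitz-equivalent sector is null; `IsHurwitzNull.symm`; `IsHurwitzNull.monodromy_eq_one`;
`IsHurwitzNull.even_length`) now live in the Literature namespace opened above, with the SAME names, so
the registered stub signatures below are textually unchanged. -/

/-! ## Stub 1 — the dictionary, REDUCED to named Literature facts (reshape s4, lead c10 wave 2)

The wave-2 worker's Literature file `SteinBisectionAchiralWordModel.lean` (p163059, ACCEPTED; seam
lemmas `SteinBisectionSeam.lean` p162429) states the printed inputs of the dictionary as named facts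
and PROVES the assembly `exists_achiralWordModel_of_steinBisection`; so the old
`stub_achiralWordModel` is now a theorem (`achiralWordModel_of_facts`) and the registered stub is the
conjunction of the five facts — a FACT DEBT: `steinDomain_nonempty_steinPALF` (AO 2001 Thm 5 /
LP 2001, `SteinDomainPALF.lean` p159609), `exists_steinPALF_openBook_eq_of_isContacto` (Giroux 2002
common positive stabilisation realised on Stein PALFs, pushed to connected binding),
`exists_wordModel_of_steinPALF_gluing` (Kas 1980 + Etnyre–Fuller 2006 Prop 12 gluing bookkeeping),
`nonempty_homeomorph_of_isLefschetzHandlebodyOver` (uniqueness of `X(P; w)` over connected-boundary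
pages), `length_eq_bettiNumber_of_isLefschetzHandlebodyOver` (Euler count, GS §8.2) — the last one PROVED
(s7) from E-d `finrank_singularHomology_one_eq_bettiNumber_of_isPageSystem`, itself PROVED (s8): fact E is
DISCHARGED and the stub keeps the four remaining facts. -/

/-- **Stub 1′ — THE DICTIONARY FACTS (named Literature facts, `SteinDomainPALF.lean` p159609 and
`SteinBisectionAchiralWordModel.lean` p163059).** Each is a printed theorem; discharging them
(`_holds`) is Literature debt, not research. [cite: AkbulutOzbagci2001, Thm 5] -/
theorem stub_factDictionary :
    steinDomain_nonempty_steinPALF ∧ exists_steinPALF_openBook_eq_of_isContacto ∧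
    exists_wordModel_of_steinPALF_gluing ∧ nonempty_homeomorph_of_isLefschetzHandlebodyOver := by
  sorry

/-- **E-d holds** (reshape s8, lead c10 wave 5): the first Betti number of a closed 3-manifold whose
open book is trivialised by a page system with connected page boundary is `b₁(P)` — the tree theorem
`IsPageSystem.finrank_singularHomology_one_eq_bettiNumber` (`PageSystemTopology.lean` p168915,
`PageSystemBinding.lean` p168972, `PageSystemBetti.lean` p169261). [cite: EtnyreFuller2006, §2] -/
theorem factEd_holds : finrank_singularHomology_one_eq_bettiNumber_of_isPageSystem :=
  fun _ _ _ _ _ _ _ _ hP _ _ _ _ _ _ _ _ _ hJ =>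
    IsPageSystem.finrank_singularHomology_one_eq_bettiNumber hP hJ

/-- **Fact E DISCHARGED (reshape s7/s8, lead c10 wave 5; tree `_holds`: `LefschetzHandlebodyEulerHolds.lean`).** The Euler count
`length_eq_bettiNumber_of_isLefschetzHandlebodyOver` (GS 1999 §8.2: a ℚ-acyclic `X(P; w)` over a
page with connected boundary has `|w| = b₁(P)`) is PROVED in the tree
(`LefschetzHandlebodyEuler.lean`, p168545: E-a `IsMultiAttachment.finRelHomology_relEuler` p167378 +
E-b Morse count + E-c `finrank_singularHomology_one_boundaryData_eq` p166836) from the smaller named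
fact E-d `finrank_singularHomology_one_eq_bettiNumber_of_isPageSystem` (b₁ of an identity-monodromy
open book with connected page boundary, Etnyre–Fuller 2006 §2), which is what conjunct 5 of
`stub_factDictionary` now asks for. [cite: GompfStipsiczGSM1999, §8.2] -/
theorem factE_of_factDictionary
    (hEd : finrank_singularHomology_one_eq_bettiNumber_of_isPageSystem) :
    length_eq_bettiNumber_of_isLefschetzHandlebodyOver :=
  length_eq_bettiNumber_of_isLefschetzHandlebodyOver_of_isPageSystemBetti hEd

/-- **The dictionary (old Stub 1, now a theorem modulo `stub_factDictionary`).** Let the nonempty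
connected 4-manifold `M` carry an acyclic common-contact Stein bisection (the crux hypothesis
verbatim, WITHOUT `M ≃ₕ S⁴`). Then there are a compact connected oriented page `P` with CONNECTED
nonempty boundary and two POSITIVE words `a`, `b` over `P` with the same monodromy, each of length
`b₁(P)`, with ℚ-acyclic Lefschetz handlebodies, such that `M` is the closed achiral Lefschetz model
of `a · b̄`. Proof: `exists_achiralWordModel_of_steinBisection` (tree, p163059) applied to the five
facts, the halves being connected by `PlanarBisectionExists.connectedSpace₁/₂` (tree).
[cite: AkbulutOzbagci2001, Thm 5] -/
theorem achiralWordModel_of_facts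
    (M : Type) [TopologicalSpace M] [T2Space M] [SecondCountableTopology M]
    [ChartedSpace (𝔼 4) M] [IsManifold (𝓡 4) ∞ M] [Nonempty M] [ConnectedSpace M]
    (W₁ : Type) [TopologicalSpace W₁] [ChartedSpace (EuclideanHalfSpace 4) W₁] [IsManifold (𝓡∂ 4) ∞ W₁]
    [CompactSpace W₁]
    (W₂ : Type) [TopologicalSpace W₂] [ChartedSpace (EuclideanHalfSpace 4) W₂] [IsManifold (𝓡∂ 4) ∞ W₂]
    [CompactSpace W₂]
    (J₁ : SteinStructure W₁) (J₂ : SteinStructure W₂) (e₁ : W₁ → M) (e₂ : W₂ → M)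
    (he₁ : Manifold.IsSmoothEmbedding (𝓡∂ 4) (𝓡 4) ∞ e₁)
    (he₂ : Manifold.IsSmoothEmbedding (𝓡∂ 4) (𝓡 4) ∞ e₂)
    (hcover : range e₁ ∪ range e₂ = univ)
    (hseam₁ : range e₁ ∩ range e₂ = e₁ '' (𝓡∂ 4).boundary W₁)
    (hseam₂ : range e₁ ∩ range e₂ = e₂ '' (𝓡∂ 4).boundary W₂)
    (hξ : ∀ w₁ w₂, e₁ w₁ = e₂ w₂ →
      Submodule.map (mfderiv (𝓡∂ 4) (𝓡 4) e₁ w₁).toLinearMap (contactPlane J₁.J w₁) =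
      Submodule.map (mfderiv (𝓡∂ 4) (𝓡 4) e₂ w₂).toLinearMap (contactPlane J₂.J w₂))
    (hac : ∀ k, 0 < k → IsZero (singularHomology ℚ ℚ W₁ k) ∧ IsZero (singularHomology ℚ ℚ W₂ k)) :
    ∃ (P : Type) (_ : TopologicalSpace P) (_ : T2Space P) (_ : SecondCountableTopology P)
      (_ : CompactSpace P) (_ : ConnectedSpace P) (_ : ChartedSpace (EuclideanHalfSpace 2) P)
      (_ : IsManifold (𝓡∂ 2) ∞ P) (o : SmoothOrientation (𝓡∂ 2) P) (a b : List (Letter P o)),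
      ConnectedSpace ↥((𝓡∂ 2).boundary P) ∧
      IsPositiveWord a ∧ IsPositiveWord b ∧ monodromy a = monodromy b ∧
      a.length = bettiNumber ℤ P 1 ∧ b.length = bettiNumber ℤ P 1 ∧
      (∀ (W : Type) [TopologicalSpace W] [ChartedSpace (EuclideanHalfSpace 4) W],
        IsLefschetzHandlebodyOver P o (signedWord a) W →
          ∀ k, 0 < k → IsZero (singularHomology ℚ ℚ W k)) ∧
      (∀ (W : Type) [TopologicalSpace W] [ChartedSpace (EuclideanHalfSpace 4) W],
        IsLefschetzHandlebodyOver P o (signedWord b) W →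
          ∀ k, 0 < k → IsZero (singularHomology ℚ ℚ W k)) ∧
      IsAchiralLefschetzModel P o (signedWord (a ++ letterInv b)) M := by
  obtain ⟨h0, hB, hC, hD⟩ := stub_factDictionary
  have hE := factE_of_factDictionary factEd_holds
  haveI : ConnectedSpace W₁ :=
    Summit.SmoothPoincare4.SmoothPoincare4.Theorems.PlanarBisectionExists.connectedSpace₁ ⟨W₁, W₂, J₁, J₂, e₁, e₂, he₁, he₂, hcover, hseam₁, hseam₂, hξ⟩
  haveI : ConnectedSpace W₂ :=
    Summit.SmoothPoincare4.SmoothPoincare4.Theorems.PlanarBisectionExists.connectedSpace₂ ⟨W₁, W₂, J₁, J₂, e₁, e₂, he₁, he₂, hcover, hseam₁, hseam₂, hξ⟩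
  exact exists_achiralWordModel_of_steinBisection h0 hB hC hD hE M W₁ W₂ J₁ J₂ e₁ e₂ he₁ he₂ hcover
    hseam₁ hseam₂ hξ hac

/-! ## Stub 2 — the apex HN₁: connected-binding homotopy-sphere two-factorisation words are
Hurwitz-null -/

/-- **Stub 2 — HURWITZ NULLITY AT CONNECTED BINDING (the apex; open; REFUTABLE BY COMPUTATION, not
SPC4-shielded, not crux-implied).** Let `P = S_{g,1}` be a compact connected oriented page with
connected nonempty boundary, `a`, `b` positive words over `P` with `monodromy a = monodromy b`, both of
length `b₁(P) = 2g`, both with ℚ-acyclic positive handlebodies (so every vanishing cycle is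
NON-SEPARATING — one `Mod(P, ∂P)`-orbit — and the `2g` classes of each word are a ℚ-basis of `H₁(P)`),
and suppose the closed model `X̂(P; a · b̄)` is a homotopy 4-sphere `M`. Then `a · b̄` is HURWITZ-NULL:
reducible to `[]` by Hurwitz moves, global conjugations and deletions of adjacent mutually inverse
pairs. EVIDENCE: doubles `b = a` (zero moves, `isHurwitzNull_append_letterInv`); Hurwitz-equivalent
pairs; the card's genus-1 toy (`Mod(T_{1,1}) = B₃` tracked faithfully in `SL₂(ℤ) × ℤ`: all 240
homology-sphere two-factorisation words with curve coordinates `≤ 5`, torsion halves `|H₁| = 2, 5`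
included, are null) and THIS SEAT's independent genus-1 census (`compute/hn_genus1.py`, attached as
evidence: letters = slopes, faithful by injectivity of `B₃ → SL₂(ℤ) × ℤ`; `π₁ X̂ = ℤ²/⟨v₁, v₂, u₁, u₂⟩`
since every vanishing cycle is primitive in `F₂`): ALL 179 homotopy-sphere two-factorisation words with
`|H₁(half)| = d ≤ 30` and second-factorisation coefficients `≤ 150` are null (BFS depth `≤ 8` after
normalising by monodromy conjugation), torsion values met `d ∈ {2, 5, 13, 17}`, `0` unknown.
NECESSARY CONDITION it must pass (Disproof §13e, formal
`exists_conj_inv_of_monotoneReducible`): some `bⱼ ∈ H · aᵢ`, `H = ⟨t_{a_•}, t_{b_•}⟩`. WHY IT MIGHT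
FAIL: an `H`-orbit / quandle-cocycle invariant of signed words finer than homology could separate a
homotopy-sphere word from `[]` although `M = S⁴` (then the line dies informatively, with a new
4-manifold-free invariant in hand); or nullity may need page-changing stabilisations at `g ≥ 2`
(repair: add Hopf stabilisation once `Mod(P, ∂P) → Mod(P', ∂P')` is in the tree). CHEAPEST FALSIFIER:
genus-2 census — `Mod(S_{2,1}) ↪ Aut(F₄)` (Dehn–Nielsen–Baer), Humphries twists as explicit
automorphisms, BFS of the null calculus on complete homotopy-sphere pairs (kit, pure Python).
At `g = 1` the stub is a theorem-sized target in `B₃` (Garside normal forms) and already gives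
`M ≅ S⁴` with no AC input (line card §g=1). [cite: GompfStipsiczGSM1999, §8.4] -/
theorem stub_hurwitzNullConnectedBinding
    (P : Type) [TopologicalSpace P] [T2Space P] [SecondCountableTopology P] [CompactSpace P]
    [ConnectedSpace P] [ChartedSpace (EuclideanHalfSpace 2) P] [IsManifold (𝓡∂ 2) ∞ P]
    (hbind : ConnectedSpace ↥((𝓡∂ 2).boundary P))
    (o : SmoothOrientation (𝓡∂ 2) P) (a b : List (Letter P o))
    (ha : IsPositiveWord a) (hb : IsPositiveWord b) (hmono : monodromy a = monodromy b)
    (hlenA : a.length = bettiNumber ℤ P 1) (hlenB : b.length = bettiNumber ℤ P 1)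
    (hacA : ∀ (W : Type) [TopologicalSpace W] [ChartedSpace (EuclideanHalfSpace 4) W],
      IsLefschetzHandlebodyOver P o (signedWord a) W → ∀ k, 0 < k → IsZero (singularHomology ℚ ℚ W k))
    (hacB : ∀ (W : Type) [TopologicalSpace W] [ChartedSpace (EuclideanHalfSpace 4) W],
      IsLefschetzHandlebodyOver P o (signedWord b) W → ∀ k, 0 < k → IsZero (singularHomology ℚ ℚ W k))
    (M : Type) [TopologicalSpace M] [T2Space M] [SecondCountableTopology M]
    [ChartedSpace (𝔼 4) M] [IsManifold (𝓡 4) ∞ M] (hM : M ≃ₕ 𝕊⁴)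
    (hmodel : IsAchiralLefschetzModel P o (signedWord (a ++ letterInv b)) M) :
    IsHurwitzNull (a ++ letterInv b) := by
  sorry

/-! ## Stub 3 — the deletion tower, REDUCED to five printed inputs (reshape s2, lead c10 wave 1)

The worker's Literature file `AchiralLefschetzNullTower.lean` (p159779, ACCEPTED) states the five
printed inputs of the tower as named facts and PROVES the assembly
`exists_contractible_handlebody_of_isHurwitzNull`; so the old `stub_nullTower` is now a theorem
(`nullTower_of_facts`) and the registered stub is the conjunction of the five facts — a FACT DEBT
(two Kirby-calculus facts over page systems, XL: GS §8.2 moves / §5.2+§8.4 deletion = circle surgery;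
three M-sized: Laudenbach–Poénaru model of `[]`, Milnor trace of a circle surgery, Whitehead). -/

/-- **Stub 3′ — THE NULL-TOWER FACTS (three left: the two Kirby-calculus facts (1), (2) and
Laudenbach–Poénaru, from which fact (3) follows (p164600); facts (4) and (5) are DISCHARGED below
(p166586, p162141)) (named Literature facts, `AchiralLefschetzNullTower.lean`,
p159779).** (1) `isAchiralLefschetzModel_iff_of_move`: Hurwitz moves / global conjugation do not
change the closed model (Gompf–Stipsicz 1999 §8.2); (2) `exists_isCircleSurgery_of_deletion`: deleting
an adjacent mutually inverse pair is undone by one circle surgery (§5.2, §8.4); (3)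
`exists_isHandlebodyOfIndexLE_one_of_isAchiralLefschetzModel_nil`: `X̂(P; [])` bounds a compact
5-dimensional 1-handlebody (Laudenbach–Poénaru 1972); (4)
`exists_isHandlebodyOfIndexLE_two_of_isCircleSurgery`: the trace of a circle surgery on the boundary
of a 2-handlebody is a 2-handlebody (Milnor 1965 §3); (5)
`contractibleSpace_of_isHandlebodyOfIndexLE_two_of_homotopyEquiv_sphere`: a compact 5-dimensional
2-handlebody bounded by a homotopy 4-sphere is contractible (Hurewicz–Whitehead). Each is a printed
theorem; discharging them (`_holds`) is Literature debt, not research. [cite: GompfStipsiczGSM1999, §8.4] -/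
theorem stub_factNullTower :
    isAchiralLefschetzModel_iff_of_move.{0, 0} ∧ exists_isCircleSurgery_of_deletion.{0, 0} ∧
    exists_diffeomorph_comp_incl_eq.{0} := by
  sorry

/-- **Fact (4) of the null tower is DISCHARGED** (lead c10 wave 3, p166586 / p166776,
`AchiralLefschetzNullTowerTrace.lean`, on the Milnor 1965 Lemma 3.7 gluing brick
`AttachDataMorseGluing.lean` p166197): the trace of a circle surgery on the boundary of a compact
5-dimensional 2-handlebody is a compact 2-handlebody. [cite: Milnor1965h, Thm. 3.12] -/
theorem factNullTower_four : exists_isHandlebodyOfIndexLE_two_of_isCircleSurgery.{0} :=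
  exists_isHandlebodyOfIndexLE_two_of_isCircleSurgery_holds0

/-- **Fact (3) of the null tower from Laudenbach–Poénaru** (lead c10 wave 3, p164600,
`AchiralLefschetzNullTowerNil.lean`): the closed model of the empty word bounds a compact
5-dimensional 1-handlebody, GIVEN the Laudenbach–Poénaru extension fact
`exists_diffeomorph_comp_incl_eq` (tree named fact, `SPC4Handles.lean`; fact 3 with
`B = V = 𝔻⁴` implies Cerf `Γ₄ = 0`, so no cheaper route exists). [cite: LaudenbachPoenaruBSMF1972, main theorem] -/
theorem factNullTower_three (hLP : exists_diffeomorph_comp_incl_eq.{0}) :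
    exists_isHandlebodyOfIndexLE_one_of_isAchiralLefschetzModel_nil.{0, 0} :=
  exists_isHandlebodyOfIndexLE_one_of_isAchiralLefschetzModel_nil_holds0_of_LP hLP

/-- **Fact (5) of the null tower is DISCHARGED** (lead c10 wave 2, p162141,
`AchiralLefschetzNullTowerContractible.lean`): a compact 5-dimensional 2-handlebody bounded by a
homotopy 4-sphere is contractible. [cite: HatcherAT2002, Cor. 4.33] -/
theorem factNullTower_five :
    contractibleSpace_of_isHandlebodyOfIndexLE_two_of_homotopyEquiv_sphere.{0} :=
  contractibleSpace_of_isHandlebodyOfIndexLE_two_of_homotopyEquiv_sphere_holds0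

/-- **The null tower (old Stub 3, now a theorem modulo `stub_factNullTower`).** If the closed
4-manifold `M ≃ₕ S⁴` is the closed achiral Lefschetz model of a Hurwitz-null word `w` over a compact
connected page `P`, then `M` bounds a compact contractible smooth 5-manifold carrying a Morse function
adapted to the boundary all of whose critical points have index `≤ 2` — verbatim the hypothesis of
item stmt-SmoothPoincare4-3717. Proof: `exists_contractible_handlebody_of_isHurwitzNull` (tree,
p159779) applied to the five facts. [cite: GompfStipsiczGSM1999, §5.2] -/
theorem nullTower_of_facts
    (P : Type) [TopologicalSpace P] [T2Space P] [SecondCountableTopology P] [CompactSpace P]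
    [ConnectedSpace P] [ChartedSpace (EuclideanHalfSpace 2) P] [IsManifold (𝓡∂ 2) ∞ P]
    (o : SmoothOrientation (𝓡∂ 2) P) (w : List (Letter P o)) (hw : IsHurwitzNull w)
    (M : Type) [TopologicalSpace M] [T2Space M] [SecondCountableTopology M]
    [ChartedSpace (𝔼 4) M] [IsManifold (𝓡 4) ∞ M] (hM : M ≃ₕ 𝕊⁴)
    (hmodel : IsAchiralLefschetzModel P o (signedWord w) M) :
    ∃ (W : Type) (_ : TopologicalSpace W) (_ : T2Space W) (_ : SecondCountableTopology W)
      (_ : ChartedSpace (EuclideanHalfSpace (4 + 1)) W) (_ : IsManifold (𝓡∂ (4 + 1)) ∞ W)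
      (_ : CompactSpace W),
      ContractibleSpace W ∧
      (∃ f : W → ℝ, IsMorseAdapted (𝓡∂ (4 + 1)) f ∧
        ∀ z, IsMCriticalPt (𝓡∂ (4 + 1)) f z → morseIndex (𝓡∂ (4 + 1)) f z ≤ 2) ∧
      ∃ φ : M → W, Manifold.IsSmoothEmbedding (𝓡 4) (𝓡∂ (4 + 1)) ∞ φ ∧
        Set.range φ = (𝓡∂ (4 + 1)).boundary W := by
  obtain ⟨h1, h2, hLP⟩ := stub_factNullTower
  exact exists_contractible_handlebody_of_isHurwitzNull h1 h2 (factNullTower_three hLP) factNullTower_four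
    factNullTower_five hw M hM hmodel

/-! ## Stub 4 — the residual: presentation spheres are standard (item stmt-SmoothPoincare4-3717) -/

/-- **Stub 4 — PRESENTATION SPHERES ARE STANDARD = item stmt-SmoothPoincare4-3717 VERBATIM** (crux of
routes EntropyLadder / ConvexityLadder / RicciTranscript; SPC4-shielded; closing it there closes it
here). A homotopy 4-sphere bounding a compact contractible 5-manifold with an adapted Morse function of
index `≤ 2` (`= H⁵(𝒫)` for a balanced presentation `𝒫` of the trivial group) is `S⁴`. Known sectors:
`𝒫` (stably) Andrews–Curtis trivial ⇒ `H ≅ B⁵` (tree fact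
`IsPresentationHandlebodyFive.nonempty_diffeomorph_closedBall_of_isStablyAndrewsCurtisEquivalent`);
Gompf 1991 for the Akbulut–Kirby family. NOT NEEDED AT GENUS 1 (line card), and bypassed whenever the
deletion order itself is an AC-trivialisation (the card's `k = 4` census: 1692/1692) or the
intermediate models of the null sequence have free `π₁` (Whitehead: `F_n/⟪c⟫` free of rank `n - 1` iff
`c` primitive ⇒ every surgery circle standard ⇒ `M ≅ S⁴` directly). [cite: AndrewsCurtis1965] -/
theorem stub_presentationSpheresStandard :
    ∀ (M : Type) [TopologicalSpace M] [T2Space M] [SecondCountableTopology M]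
      [ChartedSpace (EuclideanSpace ℝ (Fin 4)) M] [IsManifold (𝓡 4) ∞ M],
      M ≃ₕ Metric.sphere (0 : EuclideanSpace ℝ (Fin 5)) 1 →
      (∃ (W : Type) (_ : TopologicalSpace W) (_ : T2Space W) (_ : SecondCountableTopology W)
        (_ : ChartedSpace (EuclideanHalfSpace (4 + 1)) W) (_ : IsManifold (𝓡∂ (4 + 1)) ∞ W)
        (_ : CompactSpace W),
        ContractibleSpace W ∧
        (∃ f : W → ℝ, Literature.Topology.FourManifolds.IsMorseAdapted (𝓡∂ (4 + 1)) f ∧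
          ∀ z, Literature.Topology.FourManifolds.IsMCriticalPt (𝓡∂ (4 + 1)) f z →
            Literature.Topology.FourManifolds.morseIndex (𝓡∂ (4 + 1)) f z ≤ 2) ∧
        ∃ φ : M → W, Manifold.IsSmoothEmbedding (𝓡 4) (𝓡∂ (4 + 1)) ∞ φ ∧
          Set.range φ = (𝓡∂ (4 + 1)).boundary W) →
      Nonempty (M ≃ₘ⟮𝓡 4, 𝓡 4⟯ Metric.sphere (0 : EuclideanSpace ℝ (Fin 5)) 1) := by
  sorry

/-! ## Composition — kernel-checked, no `sorry` of its own -/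

/-- **The line closes the crux BY NAME.** Unpack the bisection of `M ≃ₕ S⁴`; `M` is nonempty and
path connected (pulled back along the homotopy equivalence — the only uses of `M ≃ₕ S⁴` in the
dictionary step); READ the bisection as a connected-binding achiral two-factorisation model (Stub 1);
the word is Hurwitz-null (Stub 2, consumes `M ≃ₕ S⁴`); so `M` is a presentation sphere (Stub 3,
consumes `M ≃ₕ S⁴`); hence standard (Stub 4 = item 3717). -/
theorem AcyclicBisectionRigidity_of : ConvexBisection.AcyclicBisectionRigidity := by
  intro M _ _ _ _ _ e hb
  obtain ⟨W₁, _, _, _, _, W₂, _, _, _, _, J₁, J₂, e₁, e₂, he₁, he₂, hcover, hseam₁, hseam₂, hξ, hac⟩ := hb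
  haveI : Nonempty M := ⟨e.invFun northPole⟩
  haveI : PathConnectedSpace 𝕊⁴ := by
    refine isPathConnected_iff_pathConnectedSpace.mp (isPathConnected_sphere ?_ 0 zero_le_one)
    rw [← Module.finrank_eq_rank, finrank_euclideanSpace_fin]
    exact Nat.one_lt_cast.mpr (by norm_num)
  haveI : PathConnectedSpace M := pathConnectedSpace_of_homotopyEquiv e
  obtain ⟨P, _, _, _, _, _, _, _, o, a, b, hbind, ha, hb', hmono, hla, hlb, hacA, hacB, hmodel⟩ :=
    achiralWordModel_of_facts M W₁ W₂ J₁ J₂ e₁ e₂ he₁ he₂ hcover hseam₁ hseam₂ hξ hac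
  have hnull : IsHurwitzNull (a ++ letterInv b) :=
    stub_hurwitzNullConnectedBinding P hbind o a b ha hb' hmono hla hlb hacA hacB M e hmodel
  exact stub_presentationSpheresStandard M e
    (nullTower_of_facts P o (a ++ letterInv b) hnull M e hmodel)

/-! ## Cross-links (sorry-free): what is shielded and what is not -/

/-- **Stub 4 is implied by the summit** (shape `∀ M ≃ₕ S⁴, _ → M ≅ S⁴`, Disproof §1
`shielded_of_spc4`): refuters should spend nothing on it here (it is item 3717's business). Stub 2 has
NO such derivation — it is the line's teeth. -/
theorem presentationSpheresStandard_of_spc4 (h : SmoothPoincare4) :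
    ∀ (M : Type) [TopologicalSpace M] [T2Space M] [SecondCountableTopology M]
      [ChartedSpace (EuclideanSpace ℝ (Fin 4)) M] [IsManifold (𝓡 4) ∞ M],
      M ≃ₕ Metric.sphere (0 : EuclideanSpace ℝ (Fin 5)) 1 →
      (∃ (W : Type) (_ : TopologicalSpace W) (_ : T2Space W) (_ : SecondCountableTopology W)
        (_ : ChartedSpace (EuclideanHalfSpace (4 + 1)) W) (_ : IsManifold (𝓡∂ (4 + 1)) ∞ W)
        (_ : CompactSpace W),
        ContractibleSpace W ∧
        (∃ f : W → ℝ, Literature.Topology.FourManifolds.IsMorseAdapted (𝓡∂ (4 + 1)) f ∧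
          ∀ z, Literature.Topology.FourManifolds.IsMCriticalPt (𝓡∂ (4 + 1)) f z →
            Literature.Topology.FourManifolds.morseIndex (𝓡∂ (4 + 1)) f z ≤ 2) ∧
        ∃ φ : M → W, Manifold.IsSmoothEmbedding (𝓡 4) (𝓡∂ (4 + 1)) ∞ φ ∧
          Set.range φ = (𝓡∂ (4 + 1)).boundary W) →
      Nonempty (M ≃ₘ⟮𝓡 4, 𝓡 4⟯ Metric.sphere (0 : EuclideanSpace ℝ (Fin 5)) 1) :=
  fun M _ _ _ _ _ e _ => h M inferInstance inferInstance e

end Summit.SmoothPoincare4.SmoothPoincare4.Cruxes.AcyclicBisectionRigidity.HurwitzDeletionPresentation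

end
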